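import Literature.NumberTheory.EllipticCurves.AbelianVarietyModel
import Literature.NumberTheory.EllipticCurves.AbelianVarietyBridgeFull
import Literature.NumberTheory.EllipticCurves.CoordinateRingZeroLocusFinite
import HarnessLib

/-!
# Abelian-variety models of a Weierstrass curve, II: homomorphisms are isogenies

Let `(A, c, e)` and `(A', c', e')` be abelian-variety models of the Weierstrass curves `W, W'`
over a field `K` (`WeierstrassCurve.IsAbelianVarietyModel`: `A` an abelian variety, `c` an open
immersion of the affine chart `Spec K[W] ↪ A` over `K`, `e : A(K̄) ≃+ E(K̄)` equivariant and
"take coordinates" on the chart), with `W'` elliptic. This file proves **Silverman, *AEC*,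
III.4.8–III.4.9 for models: every non-zero `K`-homomorphism `f : A → A'` is, on geometric
points, an isogeny `E → E'` defined over `K`** in the sense of the tree's
`WeierstrassCurve.Isogeny` (`IsAbelianVarietyModel.exists_isogeny`):

* additive and `Γ_K`-equivariant: `pointsHom f = e' ∘ f(K̄) ∘ e⁻¹` (part I);
* **given by rational functions of the Weierstrass coordinates off a finite set**
  (`isAlgebraicOn_pointsHom`): for `f ≠ 0` part I provides `r ≠ 0` in `K[W]` with `f` mapping
  the basic open `D(r) ⊆ Spec K[W] ⊆ A` into the chart `Spec K[W'] ⊆ A'`; as `c'` is an open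
  immersion, `f` restricts to a `K`-morphism `Spec K[W][1/r] → Spec K[W']`, i.e. a `K`-algebra
  map `ψ : K[W'] → K[W][1/r]`, and writing `ψ(x') = a₁/rⁿ¹`, `ψ(y') = a₂/rⁿ²` the map on
  `K̄`-points is `(x, y) ↦ (a₁(x,y)/r(x,y)ⁿ¹, a₂(x,y)/r(x,y)ⁿ²)` at every affine point with
  `r(x, y) ≠ 0` (AEC II.1–II.2, III.4: an isogeny is a rational map regular on the smooth
  curve); the exceptional points — `O` and the zeros of `r` — are finite
  (`CoordinateRingZeroLocusFinite`);
* **finite kernel** (`finite_ker_pointsHom`, AEC III.4.9): at a non-exceptional point the value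
  is an affine point, not `O`.

Consequences: bridge data `IsAbelianVarietyModel.bridgeFull` (an `AbelianVarietyBridgeFull W W'`
from models of two elliptic curves, all four `Hom`-compatibilities being instances of
`exists_isogeny`), and `nonempty_abelianVarietyBridgeFull_of_models` /
`nonempty_abelianVarietyBridge_symm_of_models` / `nonempty_abelianVarietyBridge_of_models`: the
three named facts of `AbelianVarietyBridge{,Full}` follow from the existence of models, i.e. from
the construction of the smooth plane cubic as a `K`-group scheme with its affine chart and points
(AEC III.3.1(c), III.3.6) — the remaining, model-dependent half.

## References

* [SilvermanAEC2009] J. H. Silverman, *The Arithmetic of Elliptic Curves*, 2nd ed., GTM 106,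
  Springer 2009: II.1–II.2, III.4 (Definition; II.2.3), III.4.8, III.4.9.
* [MumfordAV1970] D. Mumford, *Abelian Varieties*, §4.

## Design

No named facts; everything is proved from the `IsAbelianVarietyModel` hypotheses. The passage
from Mathlib's bivariate `K[X][Y]` to the `MvPolynomial (Fin 2) K̄` of `Isogeny.IsAlgebraicOn`
is the ring map `toMv` (`affineEval_mk_eq_eval_toMv`). `namespace WeierstrassCurve`.
-/

noncomputable section

open CategoryTheory AlgebraicGeometry Polynomial
open Literature.AlgebraicGeometry.Motives
open scoped Polynomial.Bivariate

universe u

namespace WeierstrassCurve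

variable {K : Type u} [Field K]

/-! ## From bivariate polynomials to `MvPolynomial (Fin 2)` -/

section ToMv

variable (L : Type u) [CommRing L] [Algebra K L]

/-- `K[X][Y] → L[x₀, x₁]`, `X ↦ x₀`, `Y ↦ x₁` (coefficients through `K → L`): the dictionary
between Mathlib's bivariate Weierstrass polynomials and the two-variable polynomials of
`WeierstrassCurve.IsAlgebraicOn`. [folklore] -/
def toMv : K[X][Y] →+* MvPolynomial (Fin 2) L :=
  eval₂RingHom (eval₂RingHom (MvPolynomial.C.comp (algebraMap K L)) (MvPolynomial.X 0))
    (MvPolynomial.X 1)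

/-- `toMv` on constants. [folklore] -/
@[simp]
theorem toMv_C_C (k : K) : toMv L (C (C k)) = MvPolynomial.C (algebraMap K L k) := by
  simp [toMv]

/-- `toMv (X) = x₀`. [folklore] -/
@[simp]
theorem toMv_C_X : toMv L (C X : K[X][Y]) = MvPolynomial.X 0 := by
  simp [toMv]

/-- `toMv (Y) = x₁`. [folklore] -/
@[simp]
theorem toMv_Y : toMv L (Y : K[X][Y]) = MvPolynomial.X 1 := by
  simp [toMv]

variable {L} (W : WeierstrassCurve K)

/-- **Evaluating a function of `K[W]` at an affine point is evaluating the corresponding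
two-variable polynomial at its coordinates**: `h(x, y) = (toMv h̃)(x, y)` for a lift `h̃ ∈ K[X][Y]`
of `h`. [folklore] -/
theorem affineEval_mk_eq_eval_toMv {L : Type u} [Field L] [Algebra K L] (x y : L)
    (h : (W.baseChange L).toAffine.Equation x y) (p : K[X][Y]) :
    W.affineEval x y h (Affine.CoordinateRing.mk W.toAffine p) =
      MvPolynomial.eval ![x, y] (toMv L p) := by
  have key : ((W.affineEval x y h : W.toAffine.CoordinateRing →+* L).comp
      (Affine.CoordinateRing.mk W.toAffine)) =
      (MvPolynomial.eval ![x, y]).comp (toMv L) := by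
    refine Polynomial.ringHom_ext' (Polynomial.ringHom_ext' ?_ ?_) ?_
    · ext k
      change W.affineEval x y h (Affine.CoordinateRing.mk W.toAffine (C (C k))) =
        MvPolynomial.eval ![x, y] (toMv L (C (C k)))
      rw [toMv_C_C, MvPolynomial.eval_C, AdjoinRoot.mk_C, ← AdjoinRoot.algebraMap_eq,
        ← Polynomial.algebraMap_eq, ← IsScalarTower.algebraMap_apply, AlgHom.commutes]
    · change W.affineEval x y h (xClass W) = MvPolynomial.eval ![x, y] (toMv L (C X))
      rw [affineEval_xClass, toMv_C_X, MvPolynomial.eval_X]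
      rfl
    · change W.affineEval x y h (yClass W) = MvPolynomial.eval ![x, y] (toMv L Y)
      rw [affineEval_yClass, toMv_Y, MvPolynomial.eval_X]
      rfl
  exact congrArg (fun ψ : K[X][Y] →+* L ↦ ψ p) key

end ToMv

/-! ## The rational functions of a homomorphism of models -/

namespace IsAbelianVarietyModel

variable {W : WeierstrassCurve K} {A : AbelianVariety K}
  {c : Spec (CommRingCat.of W.toAffine.CoordinateRing) ⟶ A.X.left}
  {e : A.geomPoints ≃+ W.geomPoints} (hM : W.IsAbelianVarietyModel A c e)
  {W' : WeierstrassCurve K} {A' : AbelianVariety K}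
  {c' : Spec (CommRingCat.of W'.toAffine.CoordinateRing) ⟶ A'.X.left}
  {e' : A'.geomPoints ≃+ W'.geomPoints} (hM' : W'.IsAbelianVarietyModel A' c' e')
  (f : A ⟶ A')

local notation "K̄" => AlgebraicClosure K

/-- The localisation chart `Spec K[W][1/r] → Spec K[W]`. [folklore] -/
abbrev locι (r : W.toAffine.CoordinateRing) :
    Spec (CommRingCat.of (Localization.Away r)) ⟶ Spec (CommRingCat.of W.toAffine.CoordinateRing) :=
  Spec.map (CommRingCat.ofHom (algebraMap W.toAffine.CoordinateRing (Localization.Away r)))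

/-- The image of `Spec K[W][1/r] → Spec K[W]` is `D(r)`. [folklore] -/
theorem mem_range_locι_iff (r : W.toAffine.CoordinateRing)
    (p : Spec (CommRingCat.of W.toAffine.CoordinateRing)) :
    p ∈ Set.range (locι r) ↔ r ∉ p.asIdeal := by
  have hrange := PrimeSpectrum.localization_away_comap_range (Localization.Away r) r
  change (p : PrimeSpectrum W.toAffine.CoordinateRing) ∈ Set.range (PrimeSpectrum.comap
    (algebraMap W.toAffine.CoordinateRing (Localization.Away r))) ↔ _
  rw [hrange]
  exact PrimeSpectrum.mem_basicOpen _ _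

section Restrict

variable {f} {r : W.toAffine.CoordinateRing} (hr : Set.range (locι r) ⊆ V c c' f)

include hr in
/-- On `D(r) ⊆ V_f`, `f` maps into the chart of `W'`. [folklore] -/
theorem range_locι_comp_subset :
    Set.range (locι r ≫ c ≫ AbelianVariety.Hom.toSchemeHom f) ⊆ Set.range c' := by
  rintro _ ⟨q, rfl⟩
  have hq : locι r q ∈ V c c' f := hr ⟨q, rfl⟩
  rwa [mem_V_iff, ← Scheme.Hom.comp_apply] at hq

/-- **The restriction of `f` to `D(r)`, as a morphism `Spec K[W][1/r] → Spec K[W']` into the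
chart of `W'`** (`c'` is an open immersion; Silverman, *AEC* III.4: an isogeny restricted to an
affine open). [cite: SilvermanAEC2009, III.4] -/
def restrict : Spec (CommRingCat.of (Localization.Away r)) ⟶
    Spec (CommRingCat.of W'.toAffine.CoordinateRing) :=
  haveI := hM'.isOpenImmersion_chart
  IsOpenImmersion.lift c' (locι r ≫ c ≫ AbelianVariety.Hom.toSchemeHom f)
    (range_locι_comp_subset hr)

/-- The restriction followed by the chart of `W'` is `f` on `D(r)`. [folklore] -/
@[reassoc]
theorem restrict_comp : hM'.restrict hr ≫ c' = locι r ≫ c ≫ AbelianVariety.Hom.toSchemeHom f :=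
  haveI := hM'.isOpenImmersion_chart
  IsOpenImmersion.lift_fac _ _ _

include hM in
/-- The restriction is a morphism over `K`. [folklore] -/
theorem restrict_over : hM'.restrict hr ≫
      Spec.map (CommRingCat.ofHom (algebraMap K W'.toAffine.CoordinateRing)) =
    Spec.map (CommRingCat.ofHom (algebraMap K (Localization.Away r))) := by
  rw [← hM'.chart_over, ← Category.assoc, restrict_comp, Category.assoc, Category.assoc]
  change locι r ≫ c ≫ f.hom.hom.hom.left ≫ A'.X.hom = _
  rw [Over.w f.hom.hom.hom, hM.chart_over, ← Spec.map_comp, ← CommRingCat.ofHom_comp,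
    ← IsScalarTower.algebraMap_eq]

/-- **The `K`-algebra homomorphism `ψ : K[W'] → K[W][1/r]` of the restriction of `f`**
(pull-back of functions; Silverman, *AEC* II.1–II.2). [cite: SilvermanAEC2009, II.2] -/
def pullback : W'.toAffine.CoordinateRing →ₐ[K] Localization.Away r :=
  algHomOfSpecMap (hM'.restrict hr) (hM.restrict_over hM' hr)

/-- `Spec ψ` is the restriction. [folklore] -/
theorem specMap_pullback :
    Spec.map (CommRingCat.ofHom (hM.pullback hM' hr).toRingHom) = hM'.restrict hr :=
  specMap_algHomOfSpecMap _ _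

/-! ### Values at points of `D(r)` -/

variable {x y : AlgebraicClosure K} (h : (W.baseChange (AlgebraicClosure K)).toAffine.Nonsingular x y)
  (hu : IsUnit (W.affineEval x y (And.left h) r))

/-- The extension `K[W][1/r] → K̄` of the evaluation at an affine point `(x, y)` with
`r(x, y) ≠ 0`. [folklore] -/
def evalAway : Localization.Away r →ₐ[K] K̄ :=
  IsLocalization.Away.liftAlgHom r (f := W.affineEval x y h.left) hu

/-- `evalAway` extends the evaluation at `(x, y)`. [folklore] -/
@[simp]
theorem evalAway_algebraMap (a : W.toAffine.CoordinateRing) :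
    evalAway h hu (algebraMap _ (Localization.Away r) a) = W.affineEval x y h.left a := by
  rw [evalAway, IsLocalization.Away.liftAlgHom_apply, IsLocalization.Away.lift_eq]
  rfl

/-- `Spec (evalAway) → Spec K[W][1/r] → Spec K[W]` is the point `(x, y)`. [folklore] -/
theorem specMap_evalAway_comp_locι :
    Spec.map (CommRingCat.ofHom (evalAway h hu).toRingHom) ≫ locι r =
      Spec.map (CommRingCat.ofHom (W.affineEval x y h.left).toRingHom) := by
  rw [← Spec.map_comp, ← CommRingCat.ofHom_comp]
  congr 2
  exact RingHom.ext fun a ↦ evalAway_algebraMap h hu a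

/-- The coordinates of the image point: `(x', y') = (ψ(x̄')(x, y), ψ(ȳ')(x, y))`. [folklore] -/
abbrev imgX : K̄ := evalAway h hu (hM.pullback hM' hr (xClass W'))

/-- See `imgX`. [folklore] -/
abbrev imgY : K̄ := evalAway h hu (hM.pullback hM' hr (yClass W'))

/-- The image coordinates satisfy the Weierstrass equation of `W'`. [folklore] -/
theorem equation_img : (W'.baseChange K̄).toAffine.Equation (hM.imgX hM' hr h hu) (hM.imgY hM' hr h hu) :=
  W'.equation_algHom ((evalAway h hu).comp (hM.pullback hM' hr))

/-- The image coordinates are non-singular (`W'` elliptic). [folklore] -/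
theorem nonsingular_img [W'.IsElliptic] :
    (W'.baseChange K̄).toAffine.Nonsingular (hM.imgX hM' hr h hu) (hM.imgY hM' hr h hu) :=
  haveI : (W'.baseChange K̄).IsElliptic := inferInstanceAs ((W'.map (algebraMap K K̄)).IsElliptic)
  Affine.equation_iff_nonsingular.mp (hM.equation_img hM' hr h hu)

include hM hM' in
/-- **`f` maps the chart point `(x, y)`, `r(x, y) ≠ 0`, to the chart point `(x', y')`.**
[cite: SilvermanAEC2009, III.4] -/
theorem chartPoint_comp_eq :
    W.chartPoint (X := A.X) c hM.chart_over x y h.left ≫ f.hom.hom.hom =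
      W'.chartPoint (X := A'.X) c' hM'.chart_over (hM.imgX hM' hr h hu) (hM.imgY hM' hr h hu)
        (hM.equation_img hM' hr h hu) := by
  ext : 1
  change (Spec.map _ ≫ c) ≫ AbelianVariety.Hom.toSchemeHom f = Spec.map _ ≫ c'
  have hev : (evalAway h hu).comp (hM.pullback hM' hr) =
      W'.affineEval (hM.imgX hM' hr h hu) (hM.imgY hM' hr h hu) (hM.equation_img hM' hr h hu) :=
    W'.affine_algHom_ext (by rw [affineEval_xClass]; rfl) (by rw [affineEval_yClass]; rfl)
  rw [Category.assoc, ← specMap_evalAway_comp_locι h hu, Category.assoc, ← restrict_comp hM' hr,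
    ← specMap_pullback hM hM' hr, ← Category.assoc, ← Spec.map_comp, ← CommRingCat.ofHom_comp,
    AlgHom.toRingHom_eq_coe, AlgHom.toRingHom_eq_coe, AlgHom.toRingHom_eq_coe,
    ← AlgHom.comp_toRingHom, hev]

include hM hM' in
/-- **The value of `pointsHom f` at an affine point `(x, y)` with `r(x, y) ≠ 0` is the affine point
`(x', y')`.** [cite: SilvermanAEC2009, III.4.8] -/
theorem pointsHom_some_eq [W'.IsElliptic] :
    pointsHom e e' f (Affine.Point.some x y h) =
      Affine.Point.some (hM.imgX hM' hr h hu) (hM.imgY hM' hr h hu) (hM.nonsingular_img hM' hr h hu) := by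
  rw [pointsHom_apply, hM.e_symm_some, AbelianVariety.Hom.geomPointsMap_ofMul, AlgPoints.map_apply,
    hM.chartPoint_comp_eq hM' hr h hu]
  exact hM'.e_chartPoint _ _ (hM.nonsingular_img hM' hr h hu)

/-! ### The rational functions -/

/-- A lift to `K[X][Y]` of an element of `K[W]`. [folklore] -/
def polyLift (a : W.toAffine.CoordinateRing) : K[X][Y] := (AdjoinRoot.mk_surjective a).choose

/-- `polyLift a` lifts `a`. [folklore] -/
theorem mk_polyLift (a : W.toAffine.CoordinateRing) :
    Affine.CoordinateRing.mk W.toAffine (polyLift a) = a :=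
  (AdjoinRoot.mk_surjective a).choose_spec

/-- Numerator and exponent of `ψ(x̄') = a₁ / rⁿ¹ ∈ K[W][1/r]`. [folklore] -/
abbrev secX : W.toAffine.CoordinateRing × ℕ := IsLocalization.Away.sec r (hM.pullback hM' hr (xClass W'))

/-- Numerator and exponent of `ψ(ȳ') = a₂ / rⁿ² ∈ K[W][1/r]`. [folklore] -/
abbrev secY : W.toAffine.CoordinateRing × ℕ := IsLocalization.Away.sec r (hM.pullback hM' hr (yClass W'))

/-- `x'(x, y) · r(x, y)ⁿ¹ = a₁(x, y)`. [folklore] -/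
theorem imgX_mul : hM.imgX hM' hr h hu * W.affineEval x y h.left r ^ (hM.secX hM' hr).2 =
    W.affineEval x y h.left (hM.secX hM' hr).1 := by
  have hs := congrArg (evalAway h hu) (IsLocalization.Away.sec_spec r (hM.pullback hM' hr (xClass W')))
  rwa [map_mul, evalAway_algebraMap, evalAway_algebraMap, map_pow] at hs

/-- `y'(x, y) · r(x, y)ⁿ² = a₂(x, y)`. [folklore] -/
theorem imgY_mul : hM.imgY hM' hr h hu * W.affineEval x y h.left r ^ (hM.secY hM' hr).2 =
    W.affineEval x y h.left (hM.secY hM' hr).1 := by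
  have hs := congrArg (evalAway h hu) (IsLocalization.Away.sec_spec r (hM.pullback hM' hr (yClass W')))
  rwa [map_mul, evalAway_algebraMap, evalAway_algebraMap, map_pow] at hs

/-- The numerator polynomial `P₁`. [folklore] -/
abbrev polyP₁ : MvPolynomial (Fin 2) K̄ := toMv K̄ (polyLift (hM.secX hM' hr).1)
/-- The denominator polynomial `Q₁ = r̃ⁿ¹`. [folklore] -/
abbrev polyQ₁ : MvPolynomial (Fin 2) K̄ := toMv K̄ (polyLift r) ^ (hM.secX hM' hr).2
/-- The numerator polynomial `P₂`. [folklore] -/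
abbrev polyP₂ : MvPolynomial (Fin 2) K̄ := toMv K̄ (polyLift (hM.secY hM' hr).1)
/-- The denominator polynomial `Q₂ = r̃ⁿ²`. [folklore] -/
abbrev polyQ₂ : MvPolynomial (Fin 2) K̄ := toMv K̄ (polyLift r) ^ (hM.secY hM' hr).2

/-- `(toMv ã)(x, y) = a(x, y)`. [folklore] -/
theorem eval_toMv_polyLift (a : W.toAffine.CoordinateRing) :
    MvPolynomial.eval ![x, y] (toMv K̄ (polyLift a)) = W.affineEval x y h.left a := by
  rw [← affineEval_mk_eq_eval_toMv, mk_polyLift]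

include hM hM' hu in
/-- **At an affine point `(x, y)` with `r(x, y) ≠ 0`, `pointsHom f` agrees with the rational map
`(P₁/Q₁, P₂/Q₂)`** (Silverman, *AEC* III.4: isogenies are given by rational functions).
[cite: SilvermanAEC2009, III.4] -/
theorem agreesWithRationalMapAt [W'.IsElliptic] :
    AgreesWithRationalMapAt W W' (hM.polyP₁ hM' hr) (hM.polyQ₁ hM' hr) (hM.polyP₂ hM' hr)
      (hM.polyQ₂ hM' hr) (pointsHom e e' f) (Affine.Point.some x y h) := by
  have hr0 : W.affineEval x y h.left r ≠ 0 := hu.ne_zero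
  have hQ₁ : MvPolynomial.eval ![x, y] (hM.polyQ₁ hM' hr) = W.affineEval x y h.left r ^ (hM.secX hM' hr).2 := by
    rw [map_pow, eval_toMv_polyLift h]
  have hQ₂ : MvPolynomial.eval ![x, y] (hM.polyQ₂ hM' hr) = W.affineEval x y h.left r ^ (hM.secY hM' hr).2 := by
    rw [map_pow, eval_toMv_polyLift h]
  have hP₁ : MvPolynomial.eval ![x, y] (hM.polyP₁ hM' hr) = W.affineEval x y h.left (hM.secX hM' hr).1 :=
    eval_toMv_polyLift h _
  have hP₂ : MvPolynomial.eval ![x, y] (hM.polyP₂ hM' hr) = W.affineEval x y h.left (hM.secY hM' hr).1 :=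
    eval_toMv_polyLift h _
  have hx' : MvPolynomial.eval ![x, y] (hM.polyP₁ hM' hr) / MvPolynomial.eval ![x, y] (hM.polyQ₁ hM' hr) =
      hM.imgX hM' hr h hu := by
    rw [hP₁, hQ₁, ← imgX_mul, mul_div_cancel_right₀ _ (pow_ne_zero _ hr0)]
  have hy' : MvPolynomial.eval ![x, y] (hM.polyP₂ hM' hr) / MvPolynomial.eval ![x, y] (hM.polyQ₂ hM' hr) =
      hM.imgY hM' hr h hu := by
    rw [hP₂, hQ₂, ← imgY_mul, mul_div_cancel_right₀ _ (pow_ne_zero _ hr0)]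
  refine ⟨x, y, h, rfl, by rw [hQ₁]; exact pow_ne_zero _ hr0, by rw [hQ₂]; exact pow_ne_zero _ hr0,
    ?_, ?_⟩
  · rw [hx', hy']
    exact hM.nonsingular_img hM' hr h hu
  · rw [hM.pointsHom_some_eq hM' hr h hu]
    congr 1 <;> simp only [hx', hy']

end Restrict

/-! ## Finiteness of the exceptional set; the isogeny -/

/-- The set of geometric points which are not affine points `(x, y)` with `r(x, y) ≠ 0`:
`O` and the zeros of `r`. [folklore] -/
def exceptional (r : W.toAffine.CoordinateRing) : Set W.geomPoints :=
  {P | ∀ (x y : K̄) (h : (W.baseChange K̄).toAffine.Nonsingular x y),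
    P = Affine.Point.some x y h → W.affineEval x y h.left r = 0}

open scoped Classical in
/-- **The exceptional set of a non-zero `r` is finite** (`O` together with the finitely many
zeros of `r`, `WeierstrassCurve.finite_setOf_algHom_apply_eq_zero`). [cite: SilvermanAEC2009, II.2] -/
theorem finite_exceptional {r : W.toAffine.CoordinateRing} (hr : r ≠ 0) : (exceptional r).Finite := by
  let img : (W.toAffine.CoordinateRing →ₐ[K] K̄) → W.geomPoints := fun φ ↦
    if hφ : (W.baseChange K̄).toAffine.Nonsingular (φ (xClass W)) (φ (yClass W)) then
      Affine.Point.some _ _ hφ else 0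
  refine ((W.finite_setOf_algHom_apply_eq_zero K̄ hr).image img).union (Set.finite_singleton 0)
    |>.subset fun P hP ↦ ?_
  rcases P with _ | ⟨x, y, h⟩
  · exact Or.inr rfl
  · refine Or.inl ⟨W.affineEval x y h.left, hP x y h rfl, ?_⟩
    have hn : (W.baseChange K̄).toAffine.Nonsingular (W.affineEval x y h.left (xClass W))
        (W.affineEval x y h.left (yClass W)) := by
      rwa [affineEval_xClass, affineEval_yClass]
    simp only [img, hn, ↓reduceDIte]
    congr 1
    · exact W.affineEval_xClass x y h.left
    · exact W.affineEval_yClass x y h.left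

include hM hM' in
/-- **On geometric points, a non-zero homomorphism of models is given by a rational map off a
finite set** (Silverman, *AEC* III.4 with II.1–II.2). [cite: SilvermanAEC2009, III.4] -/
theorem isAlgebraicOn_pointsHom [W'.IsElliptic] (hf : f ≠ 0) :
    IsAlgebraicOn W W' (pointsHom e e' f) := by
  obtain ⟨r, hr0, hr'⟩ := hM.exists_basicOpen_le_V hM' f hf
  have hr : Set.range (locι r) ⊆ V c c' f := fun p hp ↦ hr' ((mem_range_locι_iff r p).mp hp)
  refine ⟨hM.polyP₁ hM' hr, hM.polyQ₁ hM' hr, hM.polyP₂ hM' hr, hM.polyQ₂ hM' hr,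
    (finite_exceptional hr0).subset fun P hP ↦ ?_⟩
  intro x y h hPxy
  by_contra hne
  subst hPxy
  exact hP (hM.agreesWithRationalMapAt hM' hr h (isUnit_iff_ne_zero.mpr hne))

include hM hM' in
/-- **A non-zero homomorphism of models has finite kernel on points** (Silverman, *AEC* III.4.9):
off the finite exceptional set the value is an affine point, not `O`. [cite: SilvermanAEC2009, III.4.9] -/
theorem finite_ker_pointsHom [W'.IsElliptic] (hf : f ≠ 0) :
    ((pointsHom e e' f).ker : Set W.geomPoints).Finite := by
  obtain ⟨r, hr0, hr'⟩ := hM.exists_basicOpen_le_V hM' f hf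
  have hr : Set.range (locι r) ⊆ V c c' f := fun p hp ↦ hr' ((mem_range_locι_iff r p).mp hp)
  refine (finite_exceptional hr0).subset fun P hP ↦ ?_
  intro x y h hPxy
  by_contra hne
  subst hPxy
  have hval := hM.pointsHom_some_eq hM' hr h (isUnit_iff_ne_zero.mpr hne)
  have h0 : pointsHom e e' f (Affine.Point.some x y h) = 0 := hP
  rw [h0] at hval
  exact Affine.Point.some_ne_zero _ hval.symm

include hM hM' in
/-- **Homomorphisms of models are isogenies** (Silverman, *AEC* III.4.8–III.4.9): for every
non-zero `K`-homomorphism `f : A → A'` there is an isogeny `φ : E → E'` defined over `K` with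
`φ ∘ e = e' ∘ f(K̄)` on geometric points. [cite: SilvermanAEC2009, III.4.8] -/
theorem exists_isogeny [W'.IsElliptic] (hf : f ≠ 0) :
    ∃ φ : Isogeny W W', ∀ P : A.geomPoints, φ (e P) = e' (AbelianVariety.Hom.geomPointsMap f P) :=
  ⟨⟨pointsHom e e' f, hM.isAlgebraicOn_pointsHom hM' f hf, hM.pointsHom_smul hM' f,
    hM.finite_ker_pointsHom hM' f hf⟩, fun P ↦ pointsHom_e e e' f P⟩

/-! ## Bridge data and the named facts from models -/

/-- **Bridge data from models**: models of two elliptic curves give an `AbelianVarietyBridgeFull`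
(all four `Hom`-compatibilities are `exists_isogeny`). [cite: SilvermanAEC2009, III.4.8] -/
def bridgeFull [W.IsElliptic] [W'.IsElliptic] : AbelianVarietyBridgeFull W W' where
  A := A
  A' := A'
  e := e
  e' := e'
  e_smul := hM.e_smul
  e'_smul := hM'.e_smul
  exists_isogeny f hf := hM.exists_isogeny hM' f hf
  exists_isogeny_symm f hf := hM'.exists_isogeny hM f hf
  exists_isogeny_end f hf := hM.exists_isogeny hM f hf
  exists_isogeny_end' f hf := hM'.exists_isogeny hM' f hf

end IsAbelianVarietyModel

section Facts

variable (W W' : WeierstrassCurve K)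

/-- **`nonempty_abelianVarietyBridgeFull` from models**: if elliptic `W` and `W'` admit
abelian-variety models then the full bridge fact holds. [cite: SilvermanAEC2009, III.4.8] -/
theorem nonempty_abelianVarietyBridgeFull_of_models
    (h : ∀ [W.IsElliptic], ∃ (A : AbelianVariety K)
      (c : Spec (CommRingCat.of W.toAffine.CoordinateRing) ⟶ A.X.left)
      (e : A.geomPoints ≃+ W.geomPoints), W.IsAbelianVarietyModel A c e)
    (h' : ∀ [W'.IsElliptic], ∃ (A' : AbelianVariety K)
      (c' : Spec (CommRingCat.of W'.toAffine.CoordinateRing) ⟶ A'.X.left)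
      (e' : A'.geomPoints ≃+ W'.geomPoints), W'.IsAbelianVarietyModel A' c' e') :
    nonempty_abelianVarietyBridgeFull W W' := by
  intro _ _ _
  obtain ⟨A, c, e, hM⟩ := h
  obtain ⟨A', c', e', hM'⟩ := h'
  exact ⟨hM.bridgeFull hM'⟩

/-- **`nonempty_abelianVarietyBridge_symm` from models.** [cite: SilvermanAEC2009, III.4.8] -/
theorem nonempty_abelianVarietyBridge_symm_of_models
    (h : ∀ [W.IsElliptic], ∃ (A : AbelianVariety K)
      (c : Spec (CommRingCat.of W.toAffine.CoordinateRing) ⟶ A.X.left)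
      (e : A.geomPoints ≃+ W.geomPoints), W.IsAbelianVarietyModel A c e)
    (h' : ∀ [W'.IsElliptic], ∃ (A' : AbelianVariety K)
      (c' : Spec (CommRingCat.of W'.toAffine.CoordinateRing) ⟶ A'.X.left)
      (e' : A'.geomPoints ≃+ W'.geomPoints), W'.IsAbelianVarietyModel A' c' e') :
    nonempty_abelianVarietyBridge_symm W W' :=
  nonempty_abelianVarietyBridge_symm_of_full W W' (nonempty_abelianVarietyBridgeFull_of_models W W' h h')

/-- **`nonempty_abelianVarietyBridge` from models.** [cite: SilvermanAEC2009, III.4.8] -/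
theorem nonempty_abelianVarietyBridge_of_models
    (h : ∀ [W.IsElliptic], ∃ (A : AbelianVariety K)
      (c : Spec (CommRingCat.of W.toAffine.CoordinateRing) ⟶ A.X.left)
      (e : A.geomPoints ≃+ W.geomPoints), W.IsAbelianVarietyModel A c e)
    (h' : ∀ [W'.IsElliptic], ∃ (A' : AbelianVariety K)
      (c' : Spec (CommRingCat.of W'.toAffine.CoordinateRing) ⟶ A'.X.left)
      (e' : A'.geomPoints ≃+ W'.geomPoints), W'.IsAbelianVarietyModel A' c' e') :
    nonempty_abelianVarietyBridge W W' :=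
  nonempty_abelianVarietyBridge_of_full W W' (nonempty_abelianVarietyBridgeFull_of_models W W' h h')

end Facts

end WeierstrassCurve
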